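import Literature.NumberTheory.EllipticCurves.Rank1Residual.GVParityTwistTransportProofs
import Literature.NumberTheory.GaloisRepresentations.ImaginaryQuadraticCyclotomicProofs
import Summits.BirchSwinnertonDyer.Rank1Residual.AdditivePotMult.TwistPointsOver
import Summits.BirchSwinnertonDyer.Rank1Residual.X2.ResidualDevissageLine
import Mathlib.NumberTheory.LegendreSymbol.QuadraticChar.Basic
import HarnessLib

/-!
# Twist transport of a LINE DATUM along `W[p] ≃ V[p]` with signs, in the vocabulary of the reading
# fact `thm312_branch_…` (route K1 `AdditiveBranchIMC`, crux ReadingFacts, child 19297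
# `GreenbergVatsalResidualBranch` — supports only; seat `bsd-inputs-abimc-rf-p1`)

HONEST FRAMING (cell `bsd-addord`, `run/shared/lean/pub/bsd-addord/README.md` §4): THEOREMS ONLY (no
`def`, no named fact, no `sorry`); nothing is booked; BSD is not proved by any of this. This file is a
TOOL for the kernel derivation of the reading fact
`GreenbergVatsal2000.thm312_branch_unitContent_and_lambda_eq_residual_goodOrd` (hGV, item 19297: GV
Thm. (3.12) READ on the `ω^{(p−1)/2}`-branch with the residual groups of the ADDITIVE twist `W`) from
Greenberg–Vatsal's Thm. (3.11) at `χ = (·/p)` as TYPED (`thm311_quadraticTwist_…`, stated with a line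
datum on the GOOD ORDINARY curve `V`, `C • V^{(p*)} = W`) — `…GreenbergVatsalResidualBranchOfPrint.lean`.

## What

Along a group isomorphism `e : W[p] ≃ V[p]` that is `Γ_ℚ`-equivariant up to a sign `ε(σ)`
(`e(σT) = σ e(T)` if `ε σ`, `= −σ e(T)` otherwise; for the quadratic twist by `d` the sign is
`σ√d = √d`, Silverman *AEC* X.5.4, tree `exists_signEquiv_of_twist`):

* §1 `lineUnramifiedAt_map_iff_forall_smul_eq_ite` — the image line `e(Φ₀)` is unramified at `p` iff
  inertia above `p` acts on `Φ₀` through the sign (`σ • P = ±P`) — the shape of hGV's hypothesis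
  "the `χ`-twist of `Φ₀` is (un)ramified at `p`";
  `smul_eq_ite_zsmul_of_forall_map`, `smul_sub_ite_zsmul_mem_of_forall_map` — the characters of
  `Φ₀` and of `W[p]/Φ₀` are those of `e(Φ₀)` and `V[p]/e(Φ₀)` multiplied by the sign (GV p. 28:
  `W[p] ≅ V[p] ⊗ χ`).
* §2 `mem_galRange_iff_smul_geomSqrt_eq` — for a quadratic field `K ∋ θ`, `θ² = d`, `θ ∉ ℚ`:
  `σ ∈ Gal(ℚ̄/K)` iff `σ√d = √d` (hGV phrases the quadratic character through `galRange K`).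
* §3 `ite_smul_geomSqrt_pStar_eq_quadraticChar` — for `d = p* = (−1)^{(p−1)/2}p` the sign IS the
  Legendre symbol of the mod-`p` cyclotomic character, `(χ_p(σ)/p)` (the quadratic Gauss sum `s`,
  `s² = p*`, `τs = (χ_p(τ)/p)s`: Ireland–Rosen 6.3.2, tree `Rat.exists_gaussSum`) — the presentation
  of `χ = ω^{(p−1)/2}` used by `thm311_quadraticTwist_…` (`quadraticChar (ZMod p)`).
* §0 `zsmul_eq_zsmul_of_intCast_eq` — scalars act on `W[p]` through `ℤ → ℤ/p`.

References: [SilvermanAEC2009] X.5 Cor. 5.4; [GreenbergVatsal2000] §2 p. 28, §3 (24) p. 39;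
[IrelandRosen1990] Ch. 6 Prop. 6.3.2.
-/

set_option autoImplicit false
set_option linter.dupNamespace false

noncomputable section

open scoped Classical

namespace Summit.BirchSwinnertonDyer.BirchSwinnertonDyer.Theorems.AdditiveBranchIMCGreenbergVatsalResidualBranchTransport

open WeierstrassCurve Literature.NumberTheory.EllipticCurves Literature.NumberTheory.GaloisRepresentations
  Literature.NumberTheory.EllipticCurves.Rank1Residual Field IsDedekindDomain NumberField
  Summit.BirchSwinnertonDyer.Rank1Residual.AdditivePotMult
  Summit.BirchSwinnertonDyer.Rank1Residual.X2.ResidualDevissageLine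

/-! ### §0 Scalars on `W[p]` -/

section Scalars

variable {W : WeierstrassCurve ℚ} {p : ℕ} [hp : Fact p.Prime]

/-- Integers congruent mod `p` act identically on `W[p]` (`p • P = 0`). [folklore] -/
theorem zsmul_eq_zsmul_of_intCast_eq {a b : ℤ} (h : (a : ZMod p) = (b : ZMod p))
    (P : geomTorsion W (p : ℤ)) : a • P = b • P := by
  obtain ⟨k, hk⟩ := (ZMod.intCast_eq_intCast_iff_dvd_sub b a p).mp h.symm
  have hp0 : (p : ℤ) • P = 0 := by
    rw [natCast_zsmul]; exact nsmul_eq_zero_of_mem_geomTorsion P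
  have hab : a = b + p * k := by rw [← hk]; ring
  rw [hab, add_zsmul, mul_comm, mul_zsmul, hp0, zsmul_zero, add_zero]

/-- An integer acts on `W[p]` as the natural number `(a mod p).val`. [folklore] -/
theorem zsmul_eq_val_nsmul (a : ℤ) (P : geomTorsion W (p : ℤ)) :
    a • P = ((a : ZMod p).val) • P := by
  rw [← natCast_zsmul]
  refine zsmul_eq_zsmul_of_intCast_eq ?_ P
  rw [Int.cast_natCast, ZMod.natCast_zmod_val]

end Scalars

/-! ### §1 Lines and characters along a sign-equivariant `e : W[p] ≃ V[p]` -/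

section SignEquiv

variable {V W : WeierstrassCurve ℚ} {p : ℕ}
  (e : geomTorsion W (p : ℤ) ≃+ geomTorsion V (p : ℤ)) (ε : absoluteGaloisGroup ℚ → Prop)
  (hpos : ∀ σ, ε σ → ∀ T, e (σ • T) = σ • e T)
  (hneg : ∀ σ, ¬ ε σ → ∀ T, e (σ • T) = -(σ • e T))

include hpos hneg in
/-- **The image line `e(Φ₀) ≤ V[p]` is unramified at `p` iff every inertia element `σ` above `p`
acts on `Φ₀` as its sign: `σ • P = P` if `ε σ`, `σ • P = −P` otherwise** (`σ • eP = ±e(σP)`).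
[cite: SilvermanAEC2009, X.5 Cor. 5.4] -/
theorem lineUnramifiedAt_map_iff_forall_smul_eq_ite [Fact p.Prime]
    (Φ₀ : AddSubgroup (geomTorsion W (p : ℤ))) :
    LineUnramifiedAt V p (Φ₀.map e.toAddMonoidHom) ↔
      ∀ v : HeightOneSpectrum (𝓞 ℚ), (p : 𝓞 ℚ) ∈ v.asIdeal → ∀ 𝔓 ∈ v.primesAbove,
        ∀ σ ∈ 𝔓.inertia (absoluteGaloisGroup ℚ), ∀ P ∈ Φ₀,
          σ • P = (if ε σ then P else -P) := by
  constructor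
  · intro h v hv 𝔓 h𝔓 σ hσ P hP
    have h1 := h v hv 𝔓 h𝔓 σ hσ (e P) (AddSubgroup.mem_map.mpr ⟨P, hP, rfl⟩)
    change σ • e P = e P at h1
    by_cases hε : ε σ
    · rw [if_pos hε]
      rw [← hpos σ hε P] at h1
      exact e.injective h1
    · rw [if_neg hε]
      have h2 : e (σ • P) = e (-P) := by rw [hneg σ hε P, h1, map_neg]
      exact e.injective h2
  · intro h v hv 𝔓 h𝔓 σ hσ S hS
    obtain ⟨P, hP, rfl⟩ := AddSubgroup.mem_map.mp hS
    change σ • e P = e P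
    have h1 := h v hv 𝔓 h𝔓 σ hσ P hP
    by_cases hε : ε σ
    · rw [if_pos hε] at h1
      rw [← hpos σ hε P, h1]
    · rw [if_neg hε] at h1
      have h2 := hneg σ hε P
      rw [h1, map_neg, neg_inj] at h2
      exact h2.symm

include hpos hneg in
/-- **The character of `Φ₀` is the sign times the character of `e(Φ₀)`**: if `σ` acts on the image
line as the integer `n`, then `σ • P = n • P` (`ε σ`) resp. `σ • P = (−n) • P` (`¬ ε σ`) on `Φ₀`
(GV p. 28: the characters of `W[p] ≅ V[p] ⊗ χ` are `χφ`, `χψ`). [cite: GreenbergVatsal2000, §2 p. 28] -/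
theorem smul_eq_ite_zsmul_of_forall_map {Φ₀ : AddSubgroup (geomTorsion W (p : ℤ))}
    {σ : absoluteGaloisGroup ℚ} {n : ℤ}
    (h : ∀ Q ∈ Φ₀.map e.toAddMonoidHom, σ • Q = n • Q) {P : geomTorsion W (p : ℤ)} (hP : P ∈ Φ₀) :
    σ • P = (if ε σ then n else -n) • P := by
  have h1 := h (e P) (AddSubgroup.mem_map.mpr ⟨P, hP, rfl⟩)
  by_cases hε : ε σ
  · rw [if_pos hε]
    apply e.injective
    rw [hpos σ hε P, h1, map_zsmul]
  · rw [if_neg hε]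
    apply e.injective
    have h2 := hneg σ hε P
    rw [h1] at h2
    rw [h2, neg_zsmul, map_neg, map_zsmul]

include hpos hneg in
/-- **The character of `W[p]/Φ₀` is the sign times the character of `V[p]/e(Φ₀)`**: if
`σ • Q − n • Q ∈ e(Φ₀)` for every `Q ∈ V[p]`, then `σ • P − (±n) • P ∈ Φ₀` for every `P ∈ W[p]`.
[cite: GreenbergVatsal2000, §2 p. 28] -/
theorem smul_sub_ite_zsmul_mem_of_forall_map {Φ₀ : AddSubgroup (geomTorsion W (p : ℤ))}
    {σ : absoluteGaloisGroup ℚ} {n : ℤ}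
    (h : ∀ Q : geomTorsion V (p : ℤ), σ • Q - n • Q ∈ Φ₀.map e.toAddMonoidHom)
    (P : geomTorsion W (p : ℤ)) :
    σ • P - (if ε σ then n else -n) • P ∈ Φ₀ := by
  obtain ⟨R, hR, hRe⟩ := AddSubgroup.mem_map.mp (h (e P))
  change e R = σ • e P - n • e P at hRe
  by_cases hε : ε σ
  · rw [if_pos hε]
    have hR' : R = σ • P - n • P := e.injective (by rw [map_sub, map_zsmul, hpos σ hε P]; exact hRe)
    rw [← hR']
    exact hR
  · rw [if_neg hε, neg_zsmul, sub_neg_eq_add]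
    have hR' : R = -(σ • P) - n • P :=
      e.injective (by rw [map_sub, map_neg, map_zsmul, hneg σ hε P, neg_neg]; exact hRe)
    have hR'' : -R ∈ Φ₀ := neg_mem hR
    rw [hR', neg_sub, sub_neg_eq_add, add_comm] at hR''
    exact hR''

end SignEquiv

/-! ### §2 The quadratic field `K = ℚ(θ)`, `θ² = d`: `Gal(ℚ̄/K)` is the fixer of `√d` -/

section QuadraticField

variable (K : Type) [Field K] [NumberField K] {θ : K} {d : ℚ}

/-- **`σ ∈ Gal(ℚ̄/K)` iff `σ√d = √d`** for the quadratic field `K ∋ θ`, `θ² = d`, `θ ∉ ℚ`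
(`t = j(θ) ∈ ℚ̄` is `±√d`; additive-p1's sign rules `apply_rootInClosure_of_(not_)mem`). [folklore] -/
theorem mem_galRange_iff_smul_geomSqrt_eq (h2 : Module.finrank ℚ K = 2)
    (hθK : θ ∉ Set.range (algebraMap ℚ K)) (hθ : θ ^ 2 = algebraMap ℚ K d)
    (σ : absoluteGaloisGroup ℚ) :
    σ ∈ galRange (K := ℚ) K ↔ σ • geomSqrt d = geomSqrt d := by
  have hd0 : d ≠ 0 := by
    rintro rfl
    apply hθK
    rw [map_zero, sq_eq_zero_iff] at hθ
    exact ⟨0, by rw [map_zero, hθ]⟩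
  have hsq : rootInClosure K θ ^ 2 = geomSqrt d ^ 2 := by
    rw [rootInClosure_sq K hθ, geomSqrt_sq]; simp only [eq_ratCast]
  constructor
  · intro hσ
    have h1 : σ • rootInClosure K θ = rootInClosure K θ := apply_rootInClosure_of_mem K hσ
    rcases sq_eq_sq_iff_eq_or_eq_neg.mp hsq with h | h
    · rwa [h] at h1
    · rw [h, smul_neg, neg_inj] at h1
      exact h1
  · intro hσ
    by_contra hn
    have h1 : σ • rootInClosure K θ = -rootInClosure K θ := apply_rootInClosure_of_not_mem K h2 hθK hθ hn
    rcases sq_eq_sq_iff_eq_or_eq_neg.mp hsq with h | h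
    · rw [h, hσ] at h1
      exact geomSqrt_ne_neg hd0 h1
    · rw [h, smul_neg, hσ, neg_neg] at h1
      exact geomSqrt_ne_neg hd0 h1.symm

end QuadraticField

/-! ### §3 The sign at `d = p*` is the Legendre symbol of the mod-`p` cyclotomic character -/

section Legendre

variable {p : ℕ} [hp : Fact p.Prime]

/-- `(−1/p) = (−1)^{(p−1)/2}` read as `(−1)^{⌊p/2⌋}` for the odd prime `p` (Mathlib
`quadraticChar_neg_one`, `ZMod.χ₄_eq_neg_one_pow`). [folklore] -/
theorem quadraticChar_neg_one_eq_neg_one_pow (hp2 : p ≠ 2) :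
    quadraticChar (ZMod p) (-1) = (-1) ^ (p / 2) := by
  have hchar : ringChar (ZMod p) ≠ 2 := by rwa [ZMod.ringChar_zmod_n]
  rw [quadraticChar_neg_one hchar, ZMod.card p]
  exact ZMod.χ₄_eq_neg_one_pow (Nat.odd_iff.mp (hp.out.odd_of_ne_two hp2))

/-- **The sign of `σ ∈ Γ_ℚ` on `√p*` is the Legendre symbol `(χ_p(σ)/p)`** (`p` odd,
`p* = (−1)^{⌊p/2⌋}p`): the quadratic Gauss sum `s = ∑ (a/p)ζ_p^a` has `s² = p*` and
`τs = (χ_p(τ)/p)·s` (Ireland–Rosen Prop. 6.3.2; tree `Rat.exists_gaussSum`), and `s = ±√p*`.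
[cite: IrelandRosen1990, Ch. 6 Prop. 6.3.2] -/
theorem ite_smul_geomSqrt_pStar_eq_quadraticChar (hp2 : p ≠ 2) (σ : absoluteGaloisGroup ℚ) :
    (if σ • geomSqrt (((-1 : ℚ) ^ (p / 2)) * p) = geomSqrt (((-1 : ℚ) ^ (p / 2)) * p)
      then (1 : ℤ) else -1) =
      quadraticChar (ZMod p) ((modNCyclotomicCharacter ℚ p σ : (ZMod p)ˣ) : ZMod p) := by
  haveI : NeZero (p : ℚ) := ⟨by exact_mod_cast hp.out.ne_zero⟩
  set d : ℚ := ((-1 : ℚ) ^ (p / 2)) * p with hd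
  have hd0 : d ≠ 0 := mul_ne_zero (pow_ne_zero _ (by norm_num)) (by exact_mod_cast hp.out.ne_zero)
  obtain ⟨s, hs0, hs2, hsτ⟩ := Rat.exists_gaussSum (p := p) hp2
  have hs2' : s ^ 2 = geomSqrt d ^ 2 := by
    rw [hs2, geomSqrt_sq, quadraticChar_neg_one_eq_neg_one_pow hp2, hd, map_mul, map_pow,
      map_neg, map_one, map_natCast]
    push_cast
    ring
  have hu : ((modNCyclotomicCharacter ℚ p σ : (ZMod p)ˣ) : ZMod p) ≠ 0 :=
    (modNCyclotomicCharacter ℚ p σ).ne_zero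
  -- `σ • s = q • s` with `q = (χ_p(σ)/p) = ±1`, and `s = ±√d`
  have key : ∀ q : ℤ, (q = 1 ∨ q = -1) → σ • s = (q : AlgebraicClosure ℚ) * s →
      (if σ • geomSqrt d = geomSqrt d then (1 : ℤ) else -1) = q := by
    intro q hq hσs
    have hσd : σ • geomSqrt d = (q : AlgebraicClosure ℚ) * geomSqrt d := by
      rcases sq_eq_sq_iff_eq_or_eq_neg.mp hs2' with h | h
      · rw [← h]; exact hσs
      · have h' : geomSqrt d = -s := by rw [h, neg_neg]
        rw [h', smul_neg, hσs, mul_neg]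
    rcases hq with rfl | rfl
    · rw [Int.cast_one, one_mul] at hσd
      rw [if_pos hσd]
    · rw [Int.cast_neg, Int.cast_one, neg_one_mul] at hσd
      rw [if_neg]
      rw [hσd]
      exact fun h ↦ geomSqrt_ne_neg hd0 h.symm
  rcases quadraticChar_dichotomy hu with h1 | h1
  · rw [h1]; exact key 1 (Or.inl rfl) (by rw [hsτ σ, h1])
  · rw [h1]; exact key (-1) (Or.inr rfl) (by rw [hsτ σ, h1])

end Legendre

end Summit.BirchSwinnertonDyer.BirchSwinnertonDyer.Theorems.AdditiveBranchIMCGreenbergVatsalResidualBranchTransport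

end
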